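import Literature.AlgebraicGeometry.Morphisms.GeometricallyConnectedOfSection
import Mathlib.AlgebraicGeometry.Geometrically.Reduced
import Mathlib.FieldTheory.IsAlgClosed.AlgebraicClosure
import Mathlib.LinearAlgebra.Dual.Lemmas
import HarnessLib

/-!
# `h⁰(Y, 𝒪_Y) = 1` iff `Y` is geometrically connected, for `Y` proper and geometrically reduced over a field
# ([StacksProject] Tag 0BUG = Varieties Lemma 33.9.3 (7), Tag 04KV; the EGA IV₃ 12.2.4 (vi) ingredient)

Cell `hodgecm-mathlib` (D-0151), F-DAG F-6 (I) «the geometrically-connected-fibre locus of a proper flat morphism is open»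
(author B-p15 (g12), census `B-provers/B-p15/g12/CENSUS-F6I-GeomConnectedOpen.B-p15g12.md` §1), brick U3 (B-p13 (g19)):
the FIBREWISE DICTIONARY between the rank of `H⁰` and geometric connectedness, which turns the upper semicontinuity of
`s ↦ h⁰(X_s, 𝒪)` (U2) into the openness of `{s | X_s geometrically connected}` (U4).  PROOF lane, theorems only.

For a field `k` and `f : Y ⟶ Spec k` quasi-compact with `Y` quasi-separated, write `Λ := Γ(Y, 𝒪_Y)`, a `k`-algebra through
`f` (the `letI` in the statements: `f.appTop ∘ (ΓSpecIso k)⁻¹`, the convention of ★ `geometricallyConnected_of_section`).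

* §1 `exists_ringEquiv_tensor_sections_of_isPullback` — FLAT BASE CHANGE OF `H⁰` along a field extension: for a cartesian
  square `Z = Y ×_k Spec K`, `Γ(Z, 𝒪_Z) ≅ Λ ⊗_k K` compatibly with the two structure maps (Mathlib
  `isIso_pushoutSection_of_isQuasiSeparated_of_flat_right`, [StacksProject, Tag 02KH], packaged over `k`, `K` instead of
  `Γ(Spec k)`, `Γ(Spec K)`).
* §2 `geometricallyConnected_of_finrank_appTop_eq_one` — **`dim_k Λ = 1 ⇒ Y` geometrically connected** (then `Λ = k`,
  `Γ(Y_K, 𝒪) = K` has no idempotent `≠ 0, 1`, so `Y_K` is connected, ★ `Motives.preconnectedSpace_of_isIdempotentElem`);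
  no properness and no reducedness needed.
* §3 `finrank_appTop_eq_one_of_geometricallyConnected` — **`Y → Spec k` universally closed, geometrically reduced and
  geometrically connected ⇒ `dim_k Λ = 1`**: over `k̄`, `Λ̄ := Γ(Y_k̄, 𝒪)` is reduced, integral over `k̄` (Mathlib
  `isIntegral_appTop_of_universallyClosed`) with only trivial idempotents (★ `eq_zero_or_one_of_isIdempotentElem`), so every
  element is a unit or `0` (★ `isUnit_or_isNilpotent_of_isIntegral`): `Λ̄` is a field algebraic over `k̄`, i.e. `Λ̄ = k̄`
  (Mathlib `IsAlgClosed.algebraMap_bijective_of_isIntegral`); and `Λ ⊗_k k̄ = Λ̄` (§1) forces `Λ = k` (a `k`-linear form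
  killing `1` and not `x` would survive in `Λ ⊗_k k̄ → k̄`).
* §4 `finrank_appTop_eq_one_iff_geometricallyConnected` (the iff) and the FIBRE READING for `p : X ⟶ S` universally
  closed and quasi-separated at `s : S` with geometrically reduced fibre:
  `finrank_sections_fiber_eq_one_iff_geometricallyConnected`;
* §5 the same with `Γ(Spec k, 𝒪)` (resp. `Γ(Spec κ(s), 𝒪)`) as scalars through `f^♯` — the convention of U2
  `UpperSemicontinuityH0` (`finrank_sections_appTop_eq_finrank`, `…_appTop_eq_one_iff_…`, `…_fiber_appTop_eq_one_iff_…`).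

HC_CM is proved only modulo the 7 printed citations until rung 0 closes; count-neutral F-DAG capital (consumer U4 / F-6 (I)).

## References
* [StacksProject] The Stacks project, Tag 0BUG (Varieties, Lemma 33.9.3; item (7): `X` proper, geometrically reduced and
  geometrically connected ⇒ `H⁰(X, 𝒪_X) = k`), Tag 04KV (Varieties, Lemma 33.7.14), Tag 02KH (Cohomology of Schemes,
  Lemma 30.5.2: flat base change).
-/

noncomputable section

open CategoryTheory CategoryTheory.Limits AlgebraicGeometry TopologicalSpace Opposite
open TensorProduct

universe u

namespace Literature.AlgebraicGeometry.Morphisms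

/-! ## §1 Flat base change of global sections along a field extension -/

/-- **`Γ(Y ×_k Spec K, 𝒪) ≅ Γ(Y, 𝒪_Y) ⊗_k K`** for `Y → Spec k` quasi-compact and quasi-separated and a cartesian square
`Z = Y ×_{Spec k} Spec K` over `Spec φ : Spec K → Spec k`: a ring isomorphism carrying `a ⊗ 1` to `fst^♯ a` and `1 ⊗ c` to
`snd^♯ c` (flat base change of `H⁰`, Mathlib `isIso_pushoutSection_of_isQuasiSeparated_of_flat_right`, re-based from
`Γ(Spec k)`, `Γ(Spec K)` to `k`, `K` along `ΓSpecIso`). [cite: StacksProject, Tag 02KH (Cohomology of Schemes, Lemma 30.5.2)] -/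
theorem exists_ringEquiv_tensor_sections_of_isPullback {k : Type u} [Field k] {Y : Scheme.{u}}
    (f : Y ⟶ Spec (.of k)) [QuasiCompact f] [QuasiSeparatedSpace Y] {K : Type u} [Field K]
    (φ : CommRingCat.of k ⟶ CommRingCat.of K) {Z : Scheme.{u}} (fst : Z ⟶ Y) (snd : Z ⟶ Spec (.of K))
    (h : IsPullback fst snd f (Spec.map φ)) :
    letI := (f.appTop.hom.comp (Scheme.ΓSpecIso (.of k)).inv.hom).toAlgebra
    letI := φ.hom.toAlgebra
    ∃ e : Γ(Y, ⊤) ⊗[k] K ≃+* Γ(Z, ⊤),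
      (∀ a : Γ(Y, ⊤), e (a ⊗ₜ 1) = fst.appTop a) ∧
        ∀ c : K, e (1 ⊗ₜ c) = snd.appTop ((Scheme.ΓSpecIso (.of K)).inv c) := by
  letI algΛ := (f.appTop.hom.comp (Scheme.ΓSpecIso (.of k)).inv.hom).toAlgebra
  letI algK := φ.hom.toAlgebra
  haveI : CompactSpace Y := QuasiCompact.compactSpace_of_compactSpace f
  set ek := Scheme.ΓSpecIso (.of k) with hek
  set eK := Scheme.ΓSpecIso (.of K) with heK
  haveI : Flat (Spec.map φ) := by
    rw [HasRingHomProperty.Spec_iff (P := @Flat)]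
    exact inferInstanceAs (Module.Flat k K)
  -- flat base change: the square of global sections is a pushout
  have hiso := isIso_pushoutSection_of_isQuasiSeparated_of_flat_right h
    (US := ⊤) (UT := ⊤) (UX := ⊤) (UY := ⊤) le_top le_top (by simp) (isAffineOpen_top _)
    (isAffineOpen_top _) isCompact_univ isQuasiSeparated_univ
  have sq := (isIso_pushoutSection_iff h (US := ⊤) (UT := ⊤) (UX := ⊤) (UY := ⊤) le_top le_top
    (by simp)).mp hiso
  -- re-base the square along `ΓSpecIso`: corners `k`, `Λ`, `K`, `Γ(Z)`
  have happf : f.appLE ⊤ ⊤ le_top = f.appTop := (Scheme.Hom.app_eq_appLE f).symm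
  have happφ : (Spec.map φ).appLE ⊤ ⊤ le_top = (Spec.map φ).appTop := (Scheme.Hom.app_eq_appLE _).symm
  have happfst : fst.appLE ⊤ ⊤ (by simp) = fst.appTop := (Scheme.Hom.app_eq_appLE _).symm
  have happsnd : snd.appLE ⊤ ⊤ (by simp) = snd.appTop := (Scheme.Hom.app_eq_appLE _).symm
  rw [happf, happφ, happfst, happsnd] at sq
  have sq' : IsPushout (CommRingCat.ofHom (algebraMap k Γ(Y, ⊤))) (CommRingCat.ofHom (algebraMap k K))
      fst.appTop (eK.inv ≫ snd.appTop) := by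
    refine sq.of_iso ek (Iso.refl _) eK (Iso.refl _) ?_ ?_ ?_ ?_
    · -- `f^♯ = ek ≫ (f^♯ ∘ ek⁻¹)`
      rw [Iso.refl_hom, Category.comp_id]
      ext a
      change f.appTop a = f.appTop.hom (ek.inv (ek.hom a))
      rw [Iso.hom_inv_id_apply]
    · -- naturality of `ΓSpecIso`
      rw [Scheme.ΓSpecIso_naturality]
      rfl
    · rw [Iso.refl_hom, Iso.refl_hom, Category.comp_id, Category.id_comp]
    · rw [Iso.refl_hom, Category.comp_id, Iso.hom_inv_id_assoc]
  have P := CommRingCat.isPushout_tensorProduct k Γ(Y, ⊤) K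
  let e := P.isoIsPushout _ _ sq'
  refine ⟨e.commRingCatIsoToRingEquiv, fun a => ?_, fun c => ?_⟩
  · exact congr($(IsPushout.inl_isoIsPushout_hom _ _ P sq').hom a)
  · exact congr($(IsPushout.inr_isoIsPushout_hom _ _ P sq').hom c)

/-! ## §2 `dim_k Γ(Y, 𝒪_Y) = 1 ⇒` geometrically connected -/

/-- A scheme with a non-trivial ring of global sections is non-empty. [cite: StacksProject, Tag 04KV (Varieties, Lemma 33.7.14)] -/
theorem nonempty_of_nontrivial_sections (Y : Scheme.{u}) [Nontrivial Γ(Y, ⊤)] : Nonempty Y := by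
  by_contra hY
  haveI : IsEmpty Y := not_nonempty_iff.mp hY
  exact not_subsingleton Γ(Y, ⊤) inferInstance

/-- **`dim_k Γ(Y, 𝒪_Y) = 1` ⇒ `Y → Spec k` is geometrically connected** (`Y` quasi-compact and quasi-separated over `k`; no
properness, no reducedness): `Γ(Y, 𝒪_Y) = k`, so for every field extension `K/k`, `Γ(Y_K, 𝒪) = k ⊗_k K = K` (§1) has no
idempotents other than `0, 1`, whence `Y_K` is connected (★ `Motives.preconnectedSpace_of_isIdempotentElem`; non-empty
because `Y ≠ ∅`). [cite: StacksProject, Tag 04KV (Varieties, Lemma 33.7.14)] [cite: StacksProject, Tag 0BUG (Varieties, Lemma 33.9.3 (7))] -/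
theorem geometricallyConnected_of_finrank_appTop_eq_one {k : Type u} [Field k] {Y : Scheme.{u}}
    (f : Y ⟶ Spec (.of k)) [QuasiCompact f] [QuasiSeparatedSpace Y]
    (h1 : letI := (f.appTop.hom.comp (Scheme.ΓSpecIso (.of k)).inv.hom).toAlgebra
      Module.finrank k Γ(Y, ⊤) = 1) :
    GeometricallyConnected f := by
  classical
  letI algΛ := (f.appTop.hom.comp (Scheme.ΓSpecIso (.of k)).inv.hom).toAlgebra
  -- `Λ = k`: the structure map is bijective
  haveI : Nontrivial Γ(Y, ⊤) := Module.nontrivial_of_finrank_eq_succ (R := k) h1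
  haveI : Module.Finite k Γ(Y, ⊤) := Module.finite_of_finrank_eq_succ h1
  have hsurj : Function.Surjective (algebraMap k Γ(Y, ⊤)) := by
    have hinj : Function.Injective (Algebra.linearMap k Γ(Y, ⊤)) := (algebraMap k Γ(Y, ⊤)).injective
    have hfin : Module.finrank k k = Module.finrank k Γ(Y, ⊤) := by rw [Module.finrank_self, h1]
    exact (LinearMap.injective_iff_surjective_of_finrank_eq_finrank hfin).1 hinj
  haveI : Nonempty Y := nonempty_of_nontrivial_sections Y
  refine ⟨fun K _ y Z fst snd h ↦ ?_⟩
  obtain ⟨φ, rfl⟩ := Spec.map_surjective y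
  letI algK := φ.hom.toAlgebra
  obtain ⟨e, he_inl, he_inr⟩ := exists_ringEquiv_tensor_sections_of_isPullback f φ fst snd h
  -- `Z ≠ ∅`
  haveI : Surjective fst := MorphismProperty.of_isPullback (P := @Surjective) h.flip inferInstance
  haveI : Nonempty Z := by
    obtain ⟨z, -⟩ := fst.surjective (Classical.arbitrary Y)
    exact ⟨z⟩
  haveI : Nontrivial Γ(Z, ⊤) := by
    obtain ⟨z⟩ := ‹Nonempty Z›
    exact (Z.presheaf.germ ⊤ z trivial).hom.domain_nontrivial
  -- `ψ : K → Γ(Z)` is injective and SURJECTIVE (`Γ(Z) = k ⊗_k K`)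
  let ψ : K →+* Γ(Z, ⊤) := snd.appTop.hom.comp (Scheme.ΓSpecIso (.of K)).inv.hom
  have hψ : Function.Injective ψ := ψ.injective
  have hψsurj : ∀ c : Γ(Z, ⊤), ∃ b : K, c = ψ b := by
    intro c
    obtain ⟨t, rfl⟩ := e.surjective c
    induction t using TensorProduct.induction_on with
    | zero => exact ⟨0, by rw [map_zero, map_zero]⟩
    | tmul a b =>
        obtain ⟨ca, rfl⟩ := hsurj a
        refine ⟨ca • b, ?_⟩
        rw [Algebra.algebraMap_eq_smul_one, TensorProduct.smul_tmul, he_inr]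
        rfl
    | add t₁ t₂ h₁ h₂ =>
        obtain ⟨b₁, hb₁⟩ := h₁
        obtain ⟨b₂, hb₂⟩ := h₂
        exact ⟨b₁ + b₂, by rw [map_add, hb₁, hb₂, map_add]⟩
  haveI : PreconnectedSpace Z :=
    Literature.AlgebraicGeometry.Motives.preconnectedSpace_of_isIdempotentElem Z fun c hc =>
      eq_zero_or_one_of_forall_exists_sub_isNilpotent ψ hψ
        (fun c => (hψsurj c).imp fun b hb => by rw [hb, sub_self]; exact IsNilpotent.zero) c hc
  exact ⟨inferInstance⟩

/-! ## §3 Universally closed, geometrically reduced, geometrically connected `⇒ dim_k Γ(Y, 𝒪_Y) = 1` -/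

/-- **Over an algebraically closed field `K`, a universally closed, quasi-separated, REDUCED and CONNECTED `Z` has
`Γ(Z, 𝒪_Z) = K`**: `Γ(Z, 𝒪)` is reduced, integral over `K` (Mathlib `isIntegral_appTop_of_universallyClosed`) and has only
the idempotents `0, 1` (★ `eq_zero_or_one_of_isIdempotentElem`), so every element is a unit or `0` (★
`isUnit_or_isNilpotent_of_isIntegral`) — a field, algebraic over `K = K̄`, hence `K` (Mathlib
`IsAlgClosed.algebraMap_bijective_of_isIntegral`).  Stated: the structure map `K → Γ(Z, 𝒪_Z)` is bijective.
[cite: StacksProject, Tag 0BUG (Varieties, Lemma 33.9.3 (7))] -/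
theorem bijective_appTop_of_isAlgClosed {K : Type u} [Field K] [IsAlgClosed K] {Z : Scheme.{u}}
    (g : Z ⟶ Spec (.of K)) [UniversallyClosed g] [IsReduced Z] [ConnectedSpace Z] :
    Function.Bijective (g.appTop.hom.comp (Scheme.ΓSpecIso (.of K)).inv.hom) := by
  set eK := Scheme.ΓSpecIso (.of K) with heK
  let ψ : K →+* Γ(Z, ⊤) := g.appTop.hom.comp eK.inv.hom
  letI := ψ.toAlgebra
  haveI : Nontrivial Γ(Z, ⊤) := by
    obtain ⟨z⟩ := (inferInstance : Nonempty Z)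
    exact (Z.presheaf.germ ⊤ z trivial).hom.domain_nontrivial
  -- integrality over `K`
  have hint : ∀ x : Γ(Z, ⊤), IsIntegral K x := by
    intro x
    obtain ⟨p, hp, hpx⟩ := isIntegral_appTop_of_universallyClosed g x
    refine ⟨p.map eK.hom.hom, hp.map _, ?_⟩
    rw [Polynomial.eval₂_map]
    convert hpx using 2
    ext a
    change g.appTop.hom (eK.inv (eK.hom a)) = g.appTop.hom a
    rw [Iso.hom_inv_id_apply]
  have hid : ∀ e : Γ(Z, ⊤), IsIdempotentElem e → e = 0 ∨ e = 1 := eq_zero_or_one_of_isIdempotentElem Z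
  -- every element is a unit or `0`
  have hu : ∀ x : Γ(Z, ⊤), x ≠ 0 → IsUnit x := fun x hx => by
    rcases isUnit_or_isNilpotent_of_isIntegral hid (hint x) with h | h
    · exact h
    · exact (hx h.eq_zero).elim
  haveI : NoZeroDivisors Γ(Z, ⊤) := ⟨fun {a b} hab => by
    by_cases ha : a = 0
    · exact Or.inl ha
    · exact Or.inr ((hu a ha).mul_left_cancel (hab.trans (mul_zero a).symm))⟩
  haveI : IsDomain Γ(Z, ⊤) := NoZeroDivisors.to_isDomain _
  haveI : Algebra.IsIntegral K Γ(Z, ⊤) := ⟨hint⟩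
  exact IsAlgClosed.algebraMap_bijective_of_isIntegral (k := K) (K := Γ(Z, ⊤))

/-- **`Y → Spec k` universally closed (e.g. proper), quasi-separated, geometrically reduced and geometrically connected ⇒
`dim_k Γ(Y, 𝒪_Y) = 1`** ([StacksProject] Tag 0BUG (7): «`A = k`»).  Over `k̄` the base change `Z = Y_k̄` is reduced and
connected, so `Γ(Z, 𝒪) = k̄` (`bijective_appTop_of_isAlgClosed`); by flat base change `Γ(Y, 𝒪) ⊗_k k̄ ≅ Γ(Z, 𝒪)` (§1); if
some `x ∈ Γ(Y, 𝒪)` were not in `k`, a `k`-linear form `φ` with `φ(1) = 0 ≠ φ(x)` would give `(φ ⊗ 1)(x ⊗ 1) ≠ 0` although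
`x ⊗ 1 = 1 ⊗ c` for some `c ∈ k̄`. [cite: StacksProject, Tag 0BUG (Varieties, Lemma 33.9.3 (7))] -/
theorem finrank_appTop_eq_one_of_geometricallyConnected {k : Type u} [Field k] {Y : Scheme.{u}}
    (f : Y ⟶ Spec (.of k)) [UniversallyClosed f] [QuasiSeparatedSpace Y] [GeometricallyReduced f]
    [GeometricallyConnected f] :
    letI := (f.appTop.hom.comp (Scheme.ΓSpecIso (.of k)).inv.hom).toAlgebra
    Module.finrank k Γ(Y, ⊤) = 1 := by
  classical
  letI algΛ := (f.appTop.hom.comp (Scheme.ΓSpecIso (.of k)).inv.hom).toAlgebra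
  -- `Y ≠ ∅` (a geometrically connected morphism is surjective), so `k → Λ` is injective
  haveI : Nonempty Y := by
    obtain ⟨y, -⟩ := f.surjective (IsLocalRing.closedPoint k)
    exact ⟨y⟩
  haveI : Nontrivial Γ(Y, ⊤) := by
    obtain ⟨y⟩ := ‹Nonempty Y›
    exact (Y.presheaf.germ ⊤ y trivial).hom.domain_nontrivial
  -- base change to the algebraic closure
  let K : Type u := AlgebraicClosure k
  let φ : CommRingCat.of k ⟶ CommRingCat.of K := CommRingCat.ofHom (algebraMap k K)
  letI algK : Algebra k K := φ.hom.toAlgebra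
  let Z := pullback f (Spec.map φ)
  have hZ : IsPullback (pullback.fst f (Spec.map φ)) (pullback.snd f (Spec.map φ)) f (Spec.map φ) :=
    IsPullback.of_hasPullback _ _
  haveI : IsReduced Z := GeometricallyReduced.geometrically_isReduced (f := f) _ _ _ hZ
  haveI : ConnectedSpace Z := GeometricallyConnected.geometrically_connectedSpace (f := f) _ _ _ hZ
  have hψ := bijective_appTop_of_isAlgClosed (pullback.snd f (Spec.map φ))
  obtain ⟨e, he_inl, he_inr⟩ :=
    exists_ringEquiv_tensor_sections_of_isPullback f φ (pullback.fst f (Spec.map φ)) (pullback.snd f (Spec.map φ)) hZ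
  -- `k → Λ` is surjective
  have hsurj : Function.Surjective (algebraMap k Γ(Y, ⊤)) := by
    intro x
    by_contra hx
    push Not at hx
    have hx' : x ∉ LinearMap.range (Algebra.linearMap k Γ(Y, ⊤)) := by
      rintro ⟨c, hc⟩
      exact hx c hc
    obtain ⟨l, hlx, hlp⟩ := Submodule.exists_dual_map_eq_bot_of_notMem hx' inferInstance
    have hl1 : l 1 = 0 := by
      have h1 : l 1 ∈ Submodule.map l (LinearMap.range (Algebra.linearMap k Γ(Y, ⊤))) :=
        Submodule.mem_map_of_mem ⟨1, by simp⟩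
      rw [hlp] at h1
      exact (Submodule.mem_bot k).1 h1
    -- in `Γ(Z)`: `fst^♯ x = snd^♯ c` for some `c ∈ k̄`, i.e. `x ⊗ 1 = 1 ⊗ c`
    obtain ⟨c, hc⟩ := hψ.2 ((pullback.fst f (Spec.map φ)).appTop x)
    have hxc : x ⊗ₜ[k] (1 : K) = (1 : Γ(Y, ⊤)) ⊗ₜ[k] c := by
      apply e.injective
      rw [he_inl, he_inr]
      exact hc.symm
    -- apply `φ ⊗ 1 : Λ ⊗ K → k ⊗ K = K`
    have key := congrArg (fun t => TensorProduct.lid k K (LinearMap.rTensor K l t)) hxc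
    simp only [LinearMap.rTensor_tmul, TensorProduct.lid_tmul, hl1, zero_smul] at key
    rw [← Algebra.algebraMap_eq_smul_one] at key
    exact hlx ((algebraMap k K).injective (by rw [key, map_zero]))
  -- hence `Λ ≅ k` and `dim_k Λ = 1`
  have hbij : Function.Bijective (Algebra.linearMap k Γ(Y, ⊤)) :=
    ⟨(algebraMap k Γ(Y, ⊤)).injective, hsurj⟩
  rw [← (LinearEquiv.ofBijective _ hbij).finrank_eq, Module.finrank_self]

/-! ## §4 The iff and the fibre reading -/

/-- **`dim_k Γ(Y, 𝒪_Y) = 1 ⟺ Y` geometrically connected**, for `Y → Spec k` universally closed, quasi-separated and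
geometrically reduced. [cite: StacksProject, Tag 0BUG (Varieties, Lemma 33.9.3 (7))] -/
theorem finrank_appTop_eq_one_iff_geometricallyConnected {k : Type u} [Field k] {Y : Scheme.{u}}
    (f : Y ⟶ Spec (.of k)) [UniversallyClosed f] [QuasiSeparatedSpace Y] [GeometricallyReduced f] :
    letI := (f.appTop.hom.comp (Scheme.ΓSpecIso (.of k)).inv.hom).toAlgebra
    Module.finrank k Γ(Y, ⊤) = 1 ↔ GeometricallyConnected f :=
  ⟨fun h => geometricallyConnected_of_finrank_appTop_eq_one f h,
    fun _ => finrank_appTop_eq_one_of_geometricallyConnected f⟩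

/-- **Fibre reading**: for `p : X ⟶ S` universally closed and quasi-separated and a point `s` whose fibre `X_s → Spec κ(s)`
is geometrically reduced, `dim_{κ(s)} Γ(X_s, 𝒪) = 1 ⟺ X_s` is geometrically connected (`X_s = p.fiber s`, a
`κ(s)`-algebra through `p.fiberToSpecResidueField s`).  The dictionary U4 of F-6 (I) reads.
[cite: StacksProject, Tag 0BUG (Varieties, Lemma 33.9.3 (7))] -/
theorem finrank_sections_fiber_eq_one_iff_geometricallyConnected {X S : Scheme.{u}} (p : X ⟶ S) [UniversallyClosed p]
    [QuasiSeparated p] (s : S) [GeometricallyReduced (p.fiberToSpecResidueField s)] :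
    letI := ((p.fiberToSpecResidueField s).appTop.hom.comp (Scheme.ΓSpecIso (S.residueField s)).inv.hom).toAlgebra
    Module.finrank (S.residueField s) Γ(p.fiber s, ⊤) = 1 ↔ GeometricallyConnected (p.fiberToSpecResidueField s) := by
  haveI : QuasiSeparated (p.fiberToSpecResidueField s) := MorphismProperty.pullback_snd _ _ inferInstance
  haveI : UniversallyClosed (p.fiberToSpecResidueField s) := MorphismProperty.pullback_snd _ _ inferInstance
  haveI : QuasiSeparatedSpace (p.fiber s) := quasiSeparatedSpace_of_quasiSeparated (p.fiberToSpecResidueField s)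
  exact finrank_appTop_eq_one_iff_geometricallyConnected (k := S.residueField s) (p.fiberToSpecResidueField s)

/-! ## §5 The `Γ(Spec k)`-scalar convention (as read by U2 `UpperSemicontinuityH0`) -/

/-- The two scalar conventions on `Γ(Y, 𝒪_Y)` — as a `Γ(Spec k, 𝒪)`-algebra through `f^♯`, or as a `k`-algebra through
`f^♯ ∘ (ΓSpecIso k)⁻¹` — have the same rank (transport along the ring isomorphism `ΓSpecIso k`).
[cite: StacksProject, Tag 0BUG (Varieties, Lemma 33.9.3 (7))] -/
theorem finrank_sections_appTop_eq_finrank {k : Type u} [Field k] {Y : Scheme.{u}} (f : Y ⟶ Spec (.of k)) :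
    letI := f.appTop.hom.toAlgebra
    letI := (f.appTop.hom.comp (Scheme.ΓSpecIso (.of k)).inv.hom).toAlgebra
    Module.finrank Γ(Spec (.of k), ⊤) Γ(Y, ⊤) = Module.finrank k Γ(Y, ⊤) := by
  letI a₁ := f.appTop.hom.toAlgebra
  letI a₂ := (f.appTop.hom.comp (Scheme.ΓSpecIso (.of k)).inv.hom).toAlgebra
  refine Algebra.finrank_eq_of_equiv_equiv (Scheme.ΓSpecIso (.of k)).commRingCatIsoToRingEquiv (RingEquiv.refl _) ?_
  ext r
  change f.appTop.hom ((Scheme.ΓSpecIso (.of k)).inv ((Scheme.ΓSpecIso (.of k)).hom r)) = f.appTop.hom r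
  rw [Iso.hom_inv_id_apply]

/-- **`dim Γ(Y, 𝒪_Y) = 1 ⟺ Y` geometrically connected, `Γ(Spec k, 𝒪)`-scalar form** (universally closed,
quasi-separated, geometrically reduced `Y → Spec k`). [cite: StacksProject, Tag 0BUG (Varieties, Lemma 33.9.3 (7))] -/
theorem finrank_sections_appTop_eq_one_iff_geometricallyConnected {k : Type u} [Field k] {Y : Scheme.{u}}
    (f : Y ⟶ Spec (.of k)) [UniversallyClosed f] [QuasiSeparatedSpace Y] [GeometricallyReduced f] :
    letI := f.appTop.hom.toAlgebra
    Module.finrank Γ(Spec (.of k), ⊤) Γ(Y, ⊤) = 1 ↔ GeometricallyConnected f := by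
  letI a₁ := f.appTop.hom.toAlgebra
  letI a₂ := (f.appTop.hom.comp (Scheme.ΓSpecIso (.of k)).inv.hom).toAlgebra
  have h : Module.finrank Γ(Spec (.of k), ⊤) Γ(Y, ⊤) = Module.finrank k Γ(Y, ⊤) :=
    finrank_sections_appTop_eq_finrank f
  change Module.finrank Γ(Spec (.of k), ⊤) Γ(Y, ⊤) = 1 ↔ _
  rw [h]
  exact finrank_appTop_eq_one_iff_geometricallyConnected f

/-- **Fibre reading, `Γ(Spec κ(s), 𝒪)`-scalar form** (the scalars of U2's `finrank Γ(Spec κ(b), ⊤) (…)`): for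
`p : X ⟶ S` universally closed and quasi-separated with geometrically reduced fibre at `s`,
`dim_{Γ(Spec κ(s))} Γ(X_s, 𝒪) = 1 ⟺ X_s` geometrically connected. [cite: StacksProject, Tag 0BUG (Varieties, Lemma 33.9.3 (7))] -/
theorem finrank_sections_fiber_appTop_eq_one_iff_geometricallyConnected {X S : Scheme.{u}} (p : X ⟶ S)
    [UniversallyClosed p] [QuasiSeparated p] (s : S) [GeometricallyReduced (p.fiberToSpecResidueField s)] :
    letI := (p.fiberToSpecResidueField s).appTop.hom.toAlgebra
    Module.finrank Γ(Spec (S.residueField s), ⊤) Γ(p.fiber s, ⊤) = 1 ↔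
      GeometricallyConnected (p.fiberToSpecResidueField s) := by
  haveI : QuasiSeparated (p.fiberToSpecResidueField s) := MorphismProperty.pullback_snd _ _ inferInstance
  haveI : UniversallyClosed (p.fiberToSpecResidueField s) := MorphismProperty.pullback_snd _ _ inferInstance
  haveI : QuasiSeparatedSpace (p.fiber s) := quasiSeparatedSpace_of_quasiSeparated (p.fiberToSpecResidueField s)
  exact finrank_sections_appTop_eq_one_iff_geometricallyConnected (k := S.residueField s) (p.fiberToSpecResidueField s)

end Literature.AlgebraicGeometry.Morphisms

end
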